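import Mathlib
import Summits.ValiantsHypothesis.ValiantsHypothesis.Theses.NewtonUnitEquations
import Summits.ValiantsHypothesis.ValiantsHypothesis.Theorems.NewtonTauWeak.Negative.Zonogon

/-!
# `NewtonTauWeak` (stmt-ValiantsHypothesis-5904): the REGIME SPLIT — the crux is EXACTLY the
# conjunction of a "logarithmically many factors" bound and an "exponentially few products" bound

Support file (crux-strategist, 2026-08-16) for the crux
`Summit.ValiantsHypothesis.ValiantsHypothesis.Theses.NewtonUnitEquations.NewtonTauWeak`
(KPTT arXiv:1308.2286, Conjecture 1 in the weak form `2^{a m}(k t+2)^b` singled out after their Thm 1).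

The weak bound `2^{a m} (k t + 2)^b` charges the number `m` of factors exponentially and the number `k` of
products polynomially, so the statement lives in two regimes with different currencies:

* `LogFactorBound` (R1, "few factors"): for sums of `k` products of at most `m ≤ ⌊log₂ k⌋` `t`-sparse
  factors, `vert ≤ (k t + 2)^b` — a POLYNOMIAL bound in `k t` with no room for `m` at all (there `2^{a m} ≤ k^a`
  is swallowed).  This is the regime of KPTT's transfer (Thm 1, §3: after depth reduction `m = O(√n)` and
  `log₂ k = Θ(√n · log n) > m`), i.e. the ONLY regime the route's deciding theorem `closes` ever visits
  (products can be padded with zero products to force `k ≥ 2^m`).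
* `FewProductsBound` (R2, "few products"): for `k ≤ 2^m` products, `vert ≤ 2^{a m} (t + 2)^b` — here
  uniformity in `k` is FREE (`k ≤ 2^m` is paid by the `2^{O(m)}` budget) and the whole difficulty is the
  `t`-dependence under coincidences with an exponential-in-`m` budget.

`newtonTauWeak_of_subs : LogFactorBound → FewProductsBound → NewtonTauWeak` (the split glue) and
`subs_of_newtonTauWeak : NewtonTauWeak → LogFactorBound ∧ FewProductsBound` (exactness of the split) are
both elementary arithmetic (`Nat.log`, `Nat.lt_pow_succ_log_self`, `Nat.pow_log_le_self`).  So a refutation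
of either half refutes the crux, and a proof of both proves it; but only R1 bears on `closes`.

No definitions (the two regime statements are inlined; they are the sub-crux items filed on the route),
no named facts, no `sorry`.
-/

set_option linter.dupNamespace false

namespace Summit.ValiantsHypothesis.ValiantsHypothesis.Theorems.NewtonUnitEquationsNewtonTauWeak

open scoped BigOperators
open MvPolynomial
open Summit.ValiantsHypothesis.ValiantsHypothesis.Theses.NewtonUnitEquations (NewtonTauWeak)
open Summit.ValiantsHypothesis.ValiantsHypothesis.Theorems.NewtonTauWeak.Negative (vert vert_le_card_support)

namespace RegimeSplit

/-! ### The two regime statements (inlined below; they are the sub-crux items `LogFactorBound` (R1) and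
`FewProductsBound` (R2) filed on route NewtonUnitEquations — kept def-free here so that the glue theorem's
type is literally `R1-statement → R2-statement → NewtonTauWeak`).

* R1 `LogFactorBound` — the LOG-FACTOR regime: sums of `k` products of at most `⌊log₂ k⌋` `t`-sparse bivariate
  polynomials have `≤ (k t + 2)^b` Newton vertices (polynomial, no `m`; the regime of KPTT's transfer):
  `∃ b, ∀ k m t f, m ≤ Nat.log 2 k → (t-sparse) → #vert ≤ (k * t + 2) ^ b`.
* R2 `FewProductsBound` — the FEW-PRODUCTS regime: sums of `k ≤ 2^m` products of `m` `t`-sparse bivariate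
  polynomials have `≤ 2^{a m} (t + 2)^b` Newton vertices (uniformity in `k` is free here):
  `∃ a b, ∀ k m t f, k ≤ 2 ^ m → (t-sparse) → #vert ≤ 2 ^ (a * m) * (t + 2) ^ b`. -/

/-- The vertex count of the empty sum is `0`. -/
theorem ncard_extremePoints_sum_fin_zero (m : ℕ) (f : Fin 0 → Fin m → MvPolynomial (Fin 2) ℂ) :
    (Set.extremePoints ℝ (convexHull ℝ ((fun e : Fin 2 →₀ ℕ => fun i : Fin 2 => ((e i : ℕ) : ℝ)) ''
        ((∑ i, ∏ j, f i j).support : Set (Fin 2 →₀ ℕ))))).ncard = 0 := by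
  simp

/-- SPLIT GLUE (D-0019 glued split of the crux): the two regime bounds give `NewtonTauWeak` BY NAME.
Constants: `a := a₂`, `b := max b₁ b₂`.  If `m ≤ ⌊log₂ k⌋` use R1; otherwise `k < 2^{⌊log₂ k⌋+1} ≤ 2^m`
and R2 applies (`k = 0`: empty sum). -/
theorem newtonTauWeak_of_subs :
    (∃ b : ℕ, ∀ (k m t : ℕ) (f : Fin k → Fin m → MvPolynomial (Fin 2) ℂ), m ≤ Nat.log 2 k →
      (∀ i j, (f i j).support.card ≤ t) →
        (Set.extremePoints ℝ (convexHull ℝ ((fun e : Fin 2 →₀ ℕ => fun i : Fin 2 => ((e i : ℕ) : ℝ)) ''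
          ((∑ i, ∏ j, f i j).support : Set (Fin 2 →₀ ℕ))))).ncard ≤ (k * t + 2) ^ b) →
    (∃ a b : ℕ, ∀ (k m t : ℕ) (f : Fin k → Fin m → MvPolynomial (Fin 2) ℂ), k ≤ 2 ^ m →
      (∀ i j, (f i j).support.card ≤ t) →
        (Set.extremePoints ℝ (convexHull ℝ ((fun e : Fin 2 →₀ ℕ => fun i : Fin 2 => ((e i : ℕ) : ℝ)) ''
          ((∑ i, ∏ j, f i j).support : Set (Fin 2 →₀ ℕ))))).ncard ≤ 2 ^ (a * m) * (t + 2) ^ b) →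
    NewtonTauWeak := by
  rintro ⟨b₁, h₁⟩ ⟨a₂, b₂, h₂⟩
  refine ⟨a₂, max b₁ b₂, ?_⟩
  intro k m t f hf
  have hbase : 1 ≤ k * t + 2 := by omega
  by_cases hm : m ≤ Nat.log 2 k
  · calc _ ≤ (k * t + 2) ^ b₁ := h₁ k m t f hm hf
      _ ≤ (k * t + 2) ^ max b₁ b₂ := Nat.pow_le_pow_right hbase (le_max_left _ _)
      _ ≤ 2 ^ (a₂ * m) * (k * t + 2) ^ max b₁ b₂ := Nat.le_mul_of_pos_left _ (by positivity)
  · have hm' : Nat.log 2 k < m := not_le.mp hm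
    have hk : k ≤ 2 ^ m :=
      calc k ≤ 2 ^ (Nat.log 2 k + 1) := (Nat.lt_pow_succ_log_self one_lt_two k).le
        _ ≤ 2 ^ m := Nat.pow_le_pow_right (by norm_num) hm'
    rcases Nat.eq_zero_or_pos k with rfl | hkpos
    · rw [ncard_extremePoints_sum_fin_zero]; exact Nat.zero_le _
    · have ht : t + 2 ≤ k * t + 2 := by nlinarith
      calc _ ≤ 2 ^ (a₂ * m) * (t + 2) ^ b₂ := h₂ k m t f hk hf
        _ ≤ 2 ^ (a₂ * m) * (k * t + 2) ^ b₂ :=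
            Nat.mul_le_mul_left _ (Nat.pow_le_pow_left ht _)
        _ ≤ 2 ^ (a₂ * m) * (k * t + 2) ^ max b₁ b₂ :=
            Nat.mul_le_mul_left _ (Nat.pow_le_pow_right hbase (le_max_right _ _))

/-- EXACTNESS of the split: the crux implies both regime bounds (so refuting either refutes the crux).
R1 with `b := a + b` (`2^{a m} ≤ 2^{a ⌊log₂ k⌋} ≤ k^a ≤ (k t+2)^a`); R2 with `a := a + b`, `b := b`
(`k t + 2 ≤ 2^m (t + 2)`). -/
theorem subs_of_newtonTauWeak (h : NewtonTauWeak) :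
    (∃ b : ℕ, ∀ (k m t : ℕ) (f : Fin k → Fin m → MvPolynomial (Fin 2) ℂ), m ≤ Nat.log 2 k →
      (∀ i j, (f i j).support.card ≤ t) →
        (Set.extremePoints ℝ (convexHull ℝ ((fun e : Fin 2 →₀ ℕ => fun i : Fin 2 => ((e i : ℕ) : ℝ)) ''
          ((∑ i, ∏ j, f i j).support : Set (Fin 2 →₀ ℕ))))).ncard ≤ (k * t + 2) ^ b) ∧
    (∃ a b : ℕ, ∀ (k m t : ℕ) (f : Fin k → Fin m → MvPolynomial (Fin 2) ℂ), k ≤ 2 ^ m →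
      (∀ i j, (f i j).support.card ≤ t) →
        (Set.extremePoints ℝ (convexHull ℝ ((fun e : Fin 2 →₀ ℕ => fun i : Fin 2 => ((e i : ℕ) : ℝ)) ''
          ((∑ i, ∏ j, f i j).support : Set (Fin 2 →₀ ℕ))))).ncard ≤ 2 ^ (a * m) * (t + 2) ^ b) := by
  obtain ⟨a, b, h⟩ := h
  refine ⟨⟨a + b, ?_⟩, ⟨a + b, b, ?_⟩⟩
  · intro k m t f hm hf
    have hbase : 1 ≤ k * t + 2 := by omega
    rcases Nat.eq_zero_or_pos t with rfl | htpos
    · -- `t = 0`: every factor vanishes, so every product is `1` (`m = 0`) or `0`, and the sum is a constant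
      have hf0 : ∀ i j, f i j = 0 := fun i j => by
        have h0 := hf i j
        rwa [Nat.le_zero, Finset.card_eq_zero, MvPolynomial.support_eq_empty] at h0
      have hsub : (∑ i, ∏ j, f i j).support ⊆ {0} := by
        classical
        refine MvPolynomial.support_sum.trans (Finset.biUnion_subset.mpr fun i _ => ?_)
        rcases Nat.eq_zero_or_pos m with rfl | hmpos
        · simp
        · have hz : ∏ j, f i j = 0 := Finset.prod_eq_zero (Finset.mem_univ ⟨0, hmpos⟩) (hf0 i _)
          simp [hz]
      calc _ = vert (∑ i, ∏ j, f i j) := rfl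
        _ ≤ (∑ i, ∏ j, f i j).support.card := vert_le_card_support _
        _ ≤ ({0} : Finset (Fin 2 →₀ ℕ)).card := Finset.card_le_card hsub
        _ ≤ (k * 0 + 2) ^ (a + b) := by simpa using Nat.one_le_pow _ _ (by omega)
    have h2m : 2 ^ (a * m) ≤ (k * t + 2) ^ a := by
      rcases Nat.eq_zero_or_pos k with rfl | hkpos
      · have : m = 0 := by simpa using hm
        subst this; simp [Nat.one_le_pow]
      · have hkk : k ≤ k * t + 2 := by nlinarith
        calc 2 ^ (a * m) = (2 ^ m) ^ a := by rw [mul_comm, pow_mul]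
          _ ≤ (2 ^ Nat.log 2 k) ^ a := Nat.pow_le_pow_left (Nat.pow_le_pow_right (by norm_num) hm) _
          _ ≤ k ^ a := Nat.pow_le_pow_left (Nat.pow_log_le_self 2 hkpos.ne') _
          _ ≤ (k * t + 2) ^ a := Nat.pow_le_pow_left hkk _
    calc _ ≤ 2 ^ (a * m) * (k * t + 2) ^ b := h k m t f hf
      _ ≤ (k * t + 2) ^ a * (k * t + 2) ^ b := Nat.mul_le_mul_right _ h2m
      _ = (k * t + 2) ^ (a + b) := (pow_add _ _ _).symm
  · intro k m t f hk hf
    have hkt : k * t + 2 ≤ 2 ^ m * (t + 2) := by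
      have h1 : 1 ≤ 2 ^ m := Nat.one_le_two_pow
      have : k * t ≤ 2 ^ m * t := Nat.mul_le_mul_right _ hk
      nlinarith
    calc _ ≤ 2 ^ (a * m) * (k * t + 2) ^ b := h k m t f hf
      _ ≤ 2 ^ (a * m) * (2 ^ m * (t + 2)) ^ b := Nat.mul_le_mul_left _ (Nat.pow_le_pow_left hkt _)
      _ = 2 ^ ((a + b) * m) * (t + 2) ^ b := by rw [mul_pow, ← pow_mul, ← mul_assoc, ← pow_add]; ring_nf

/-- The crux is EQUIVALENT to the conjunction of its two regimes. -/
theorem newtonTauWeak_iff_subs :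
    NewtonTauWeak ↔
    ((∃ b : ℕ, ∀ (k m t : ℕ) (f : Fin k → Fin m → MvPolynomial (Fin 2) ℂ), m ≤ Nat.log 2 k →
      (∀ i j, (f i j).support.card ≤ t) →
        (Set.extremePoints ℝ (convexHull ℝ ((fun e : Fin 2 →₀ ℕ => fun i : Fin 2 => ((e i : ℕ) : ℝ)) ''
          ((∑ i, ∏ j, f i j).support : Set (Fin 2 →₀ ℕ))))).ncard ≤ (k * t + 2) ^ b) ∧
    (∃ a b : ℕ, ∀ (k m t : ℕ) (f : Fin k → Fin m → MvPolynomial (Fin 2) ℂ), k ≤ 2 ^ m →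
      (∀ i j, (f i j).support.card ≤ t) →
        (Set.extremePoints ℝ (convexHull ℝ ((fun e : Fin 2 →₀ ℕ => fun i : Fin 2 => ((e i : ℕ) : ℝ)) ''
          ((∑ i, ∏ j, f i j).support : Set (Fin 2 →₀ ℕ))))).ncard ≤ 2 ^ (a * m) * (t + 2) ^ b)) :=
  ⟨subs_of_newtonTauWeak, fun h => newtonTauWeak_of_subs h.1 h.2⟩

end RegimeSplit

end Summit.ValiantsHypothesis.ValiantsHypothesis.Theorems.NewtonUnitEquationsNewtonTauWeak
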